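import Literature.Dynamics.SymbolicDynamics.PeriodicPointFacts
import HarnessLib

/-!
# Strongly irreducible `ℤ²`-SFTs have dense periodic points (Lightwood 2003) — proof

Discharge of the named fact `Lightwood2003_densePeriodic` of
`Literature/Dynamics/SymbolicDynamics/PeriodicPointFacts.lean`:
`theorem Lightwood2003_densePeriodic_holds : Lightwood2003_densePeriodic`.

## The argument (strip periodization + pigeonhole)

Let `X ⊆ A^{ℤ²}` be a subshift of finite type whose defining window lies in `[-R, R]²`
(*memory* `R`, `IsSFT.exists_memory`: a configuration all of whose `[-R, R]²`-windows are, up to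
translation, windows of one member of `X` is a member of `X`), strongly irreducible with gap
`g < G ∈ ℕ` (`IsStronglyIrreducible`: gluing along ARBITRARY, possibly infinite, sets at
sup-distance `> g`), and let `x ∈ X`, `n ∈ ℕ`. Put `s = max n (2R+1)`, `T = s + G`.

1. *Vertical recurrence.* Glue `x` on the half plane `{t < s}` with its vertical `T`-translate on
   `{t ≥ T}`; the gluing `y₀ ∈ X` has equal rows `a` and `a + T` for `0 ≤ a ≤ 2R`, so every window
   of the vertical `T`-periodization `x'` of the band `0 ≤ t < T` of `y₀` is a window of `y₀`, and
   `x' ∈ X` (`Lightwood2003.mem_of_periodic_snd`); `x'` is vertically `T`-periodic and equals `x`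
   on the rows `0 ≤ t < s`.
2. *Horizontal periodization.* The same along the first coordinate (`…_fst`, deduced from the
   vertical case by transposing coordinates) yields `u ∈ X`, horizontally `T`-periodic and equal
   to `x'` on the columns `0 ≤ c < s`.
3. *Pigeonhole.* The row blocks `u|[0,T) × [kT, kT+2R]`, `k ∈ ℕ`, take finitely many values; pick
   `k < k'` with equal blocks. By horizontal periodicity the full rows `kT + a` and `k'T + a`
   (`0 ≤ a ≤ 2R`) of `u` agree, so the vertical `(k'-k)T`-periodization `v` of the band
   `kT ≤ t < k'T` of `u` lies in `X`; it is doubly periodic (finite orbit,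
   `hasFiniteOrbit_iff_exists_shift_eq`) and `v (a, kT + b) = u (a, kT + b) = x' (a, kT + b)
   = x' (a, b) = x (a, b)` for `0 ≤ a, b < n`; its shift by `(0, kT)` is the required periodic
   point (`Lightwood2003.exists_hasFiniteOrbit_eqOn`).
4. *Density.* An open set of `A^{ℤ²}` contains, around each of its points, a cylinder on a finite
   set (`isOpen_pi_iff`); centre a box on that set by shift invariance.

Finite type is used exactly in the periodization steps (a configuration all of whose windows
occur in a member is a member), and the pigeonhole needs all but one direction already periodic:
this is where `d = 2` enters (for `ℤ^d`, `d ≥ 3`, the statement is recorded as open in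
Ceccherini-Silberstein–Coornaert 2012, §1; for SI subshifts not of finite type it fails,
Hochman 2025).

The primary source [Lightwood2003] is not held here (paywalled; acquisition requested); the
statement discharged is the vendored one, formalized from its restatement in
[CeccheriniSilbersteinCoornaert2012, §1, p. 4 of arXiv:1110.4921: "Lightwood also proved that
any strongly irreducible subshift of finite type over `ℤ²` contains a dense set of periodic
configurations"]; the proof written here is the standard elementary argument and is
self-contained (Mathlib + `StrongIrreducibility.lean` only).

## References

* [Lightwood2003] S. J. Lightwood, *Morphisms from non-periodic `ℤ²` subshifts I: constructing
  embeddings from homomorphisms*, Ergodic Theory Dynam. Systems 23 (2003) 587–609.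
* [CeccheriniSilbersteinCoornaert2012] T. Ceccherini-Silberstein, M. Coornaert, *On the density of
  periodic configurations in strongly irreducible subshifts*, Nonlinearity 25 (2012) 2119–2131, §1.
-/

open Set
open _root_.SymbolicDynamics.FullShift

namespace Literature.Dynamics.SymbolicDynamics

variable {A : Type*}

/-- A shift of a periodic point (finite orbit) is a periodic point: its orbit is contained in the
original orbit. [folklore] -/
theorem hasFiniteOrbit_shift {G : Type*} [AddMonoid G] {x : G → A} (h : HasFiniteOrbit x)
    (w : G) : HasFiniteOrbit (shift w x) := by
  refine h.subset ?_
  rintro _ ⟨w', rfl⟩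
  exact ⟨w + w', shift_add w w' x⟩

namespace Lightwood2003

/-- Rewriting the two coordinates of the argument of a configuration. [folklore] -/
theorem apply_pair_congr (x : ℤ × ℤ → A) {a b c d : ℤ} (h₁ : a = c) (h₂ : b = d) :
    x (a, b) = x (c, d) := by
  subst h₁; subst h₂; rfl

/-- Integer multiples of a period of a function on `ℤ` are periods. [folklore] -/
theorem apply_add_int_mul_eq {f : ℤ → A} {L : ℤ} (h : ∀ t, f (t + L) = f t) (q t : ℤ) :
    f (t + q * L) = f t := by
  induction q using Int.induction_on generalizing t with
  | zero => rw [zero_mul, add_zero]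
  | succ n ih => rw [show t + ((n : ℤ) + 1) * L = (t + (n : ℤ) * L) + L by ring, h, ih]
  | pred n ih =>
    have key := h (t + (-(n : ℤ) - 1) * L)
    rw [show t + (-(n : ℤ) - 1) * L + L = t + (-(n : ℤ)) * L by ring, ih] at key
    exact key.symm

/-- The shift in coordinates: `shift (a, b) x (c, d) = x (a + c, b + d)`. [folklore] -/
theorem shift_pair_apply (x : ℤ × ℤ → A) (a b c d : ℤ) :
    shift (a, b) x (c, d) = x (a + c, b + d) := rfl

/-- A finite subset of `ℤ²` lies in a box `[-m, m]²`. [folklore] -/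
theorem exists_abs_le_of_finset (I : Finset (ℤ × ℤ)) :
    ∃ m : ℕ, ∀ i ∈ I, |i.1| ≤ (m : ℤ) ∧ |i.2| ≤ (m : ℤ) := by
  refine ⟨I.sup fun i => (max |i.1| |i.2|).toNat, fun i hi => ?_⟩
  have h : (max |i.1| |i.2|).toNat ≤ I.sup fun i : ℤ × ℤ => (max |i.1| |i.2|).toNat :=
    Finset.le_sup (f := fun i : ℤ × ℤ => (max |i.1| |i.2|).toNat) hi
  have h' : max |i.1| |i.2| ≤ ((I.sup fun i : ℤ × ℤ => (max |i.1| |i.2|).toNat : ℕ) : ℤ) :=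
    Int.toNat_le.mp h
  exact ⟨le_of_max_le_left h', le_of_max_le_right h'⟩

end Lightwood2003

/-- **Memory of a `ℤ²`-SFT.** A subshift of finite type `X ⊆ A^{ℤ²}` (window form) has a
*memory* `R : ℕ`: if every `[-R, R]²`-window of a configuration `u` is, up to translation, a
window of one fixed member `y ∈ X`, then `u ∈ X`. (Take `R` with the defining window `Ω` inside
`[-R, R]²`; then every defining pattern of `u` is a defining pattern of `y`.) [folklore] -/
theorem IsSFT.exists_memory {X : Set (ℤ × ℤ → A)} (h : IsSFT X) :
    ∃ R : ℕ, ∀ ⦃u y : ℤ × ℤ → A⦄, y ∈ X →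
      (∀ p : ℤ × ℤ, ∃ p' : ℤ × ℤ, ∀ a b : ℤ, |a| ≤ R → |b| ≤ R →
        u (p.1 + a, p.2 + b) = y (p'.1 + a, p'.2 + b)) → u ∈ X := by
  obtain ⟨Ω, P, rfl⟩ := h
  obtain ⟨R, hR⟩ := Lightwood2003.exists_abs_le_of_finset Ω
  refine ⟨R, fun u y hy H => ?_⟩
  have hy' : ∀ q : ℤ × ℤ, (fun i : Ω => shift q y i) ∈ P := hy
  show ∀ q : ℤ × ℤ, (fun i : Ω => shift q u i) ∈ P
  intro q
  obtain ⟨q', hq'⟩ := H q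
  have key : (fun i : Ω => shift q u i) = fun i : Ω => shift q' y i := by
    funext i
    obtain ⟨h1, h2⟩ := hR i i.2
    exact hq' (i : ℤ × ℤ).1 (i : ℤ × ℤ).2 h1 h2
  rw [key]
  exact hy' q'

namespace Lightwood2003

/-- Gluing across a horizontal gap of `G` rows: strong irreducibility with gap `g < G` glues `x`
on the half plane `{t < s}` to `y` on the half plane `{t ≥ s + G}` (sets at sup-distance
`≥ G + 1 > g`). [folklore] -/
theorem glue_snd {X : Set (ℤ × ℤ → A)} {g : ℝ} (hSI : IsStronglyIrreducible X g) {G : ℕ}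
    (hG : g < G) {x y : ℤ × ℤ → A} (hx : x ∈ X) (hy : y ∈ X) (s : ℤ) :
    ∃ z ∈ X, (∀ p : ℤ × ℤ, p.2 < s → z p = x p) ∧ ∀ q : ℤ × ℤ, s + G ≤ q.2 → z q = y q := by
  have hsep : ∀ p ∈ {p : ℤ × ℤ | p.2 < s}, ∀ q ∈ {q : ℤ × ℤ | s + G ≤ q.2}, g < dist p q := by
    intro p hp q hq
    simp only [Set.mem_setOf_eq] at hp hq
    have h : (G : ℤ) < max |p.1 - q.1| |p.2 - q.2| :=
      lt_max_of_lt_right (lt_abs.mpr (Or.inr (by omega)))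
    exact lt_trans hG ((int2_gap_iff G p q).mpr h)
  obtain ⟨z, hz, hzx, hzy⟩ := hSI _ _ hsep x hx y hy
  exact ⟨z, hz, fun p hp => @hzx p hp, fun q hq => @hzy q hq⟩

/-- Gluing across a vertical gap of `G` columns: strong irreducibility with gap `g < G` glues
`x` on the half plane `{c < s}` to `y` on the half plane `{c ≥ s + G}`. [folklore] -/
theorem glue_fst {X : Set (ℤ × ℤ → A)} {g : ℝ} (hSI : IsStronglyIrreducible X g) {G : ℕ}
    (hG : g < G) {x y : ℤ × ℤ → A} (hx : x ∈ X) (hy : y ∈ X) (s : ℤ) :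
    ∃ z ∈ X, (∀ p : ℤ × ℤ, p.1 < s → z p = x p) ∧ ∀ q : ℤ × ℤ, s + G ≤ q.1 → z q = y q := by
  have hsep : ∀ p ∈ {p : ℤ × ℤ | p.1 < s}, ∀ q ∈ {q : ℤ × ℤ | s + G ≤ q.1}, g < dist p q := by
    intro p hp q hq
    simp only [Set.mem_setOf_eq] at hp hq
    have h : (G : ℤ) < max |p.1 - q.1| |p.2 - q.2| :=
      lt_max_of_lt_left (lt_abs.mpr (Or.inr (by omega)))
    exact lt_trans hG ((int2_gap_iff G p q).mpr h)
  obtain ⟨z, hz, hzx, hzy⟩ := hSI _ _ hsep x hx y hy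
  exact ⟨z, hz, fun p hp => @hzx p hp, fun q hq => @hzy q hq⟩

/-- **Periodizing a band keeps membership** (vertical version). Let `X` have memory `R`, let
`y ∈ X`, `0 < L`, `2R ≤ L`, and suppose the rows `j + a` and `j + a + L` of `y` coincide for
`0 ≤ a ≤ 2R`. If `v` is vertically `L`-periodic and agrees with `y` on the band `j ≤ t < j + L`,
then every `[-R, R]²`-window of `v` is a window of `y` (windows crossing a seam are windows of `y`
near the row `j + L`, resp. `j`), hence `v ∈ X`. [folklore] -/
theorem mem_of_periodic_snd {X : Set (ℤ × ℤ → A)} {R : ℕ}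
    (hmem : ∀ ⦃u y : ℤ × ℤ → A⦄, y ∈ X →
      (∀ p : ℤ × ℤ, ∃ p' : ℤ × ℤ, ∀ a b : ℤ, |a| ≤ R → |b| ≤ R →
        u (p.1 + a, p.2 + b) = y (p'.1 + a, p'.2 + b)) → u ∈ X)
    {y : ℤ × ℤ → A} (hy : y ∈ X) {j L : ℤ} (hL : 0 < L) (hRL : 2 * (R : ℤ) ≤ L)
    (hblock : ∀ c a : ℤ, 0 ≤ a → a ≤ 2 * R → y (c, j + a + L) = y (c, j + a))
    {v : ℤ × ℤ → A} (hv₁ : ∀ c t : ℤ, v (c, t + L) = v (c, t))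
    (hv₂ : ∀ c t : ℤ, j ≤ t → t < j + L → v (c, t) = y (c, t)) : v ∈ X := by
  refine hmem hy fun p => ?_
  -- all integer multiples of the period
  have hper : ∀ q c t : ℤ, v (c, t + q * L) = v (c, t) := fun q c t =>
    apply_add_int_mul_eq (f := fun t => v (c, t)) (fun t => hv₁ c t) q t
  -- reduce the row `p.2` into the band
  obtain ⟨t₀, ht₀, ht₀', hred⟩ :
      ∃ t₀ : ℤ, j ≤ t₀ ∧ t₀ < j + L ∧ ∀ c b : ℤ, v (c, p.2 + b) = v (c, t₀ + b) := by
    refine ⟨j + (p.2 - j) % L, ?_, ?_, fun c b => ?_⟩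
    · have := Int.emod_nonneg (p.2 - j) hL.ne'; omega
    · have := Int.emod_lt_of_pos (p.2 - j) hL; omega
    · have hdec := Int.emod_add_mul_ediv (p.2 - j) L
      have e : p.2 + b = (j + (p.2 - j) % L + b) + ((p.2 - j) / L) * L := by linarith
      rw [e, hper]
  by_cases hlow : t₀ < j + R
  · -- the window may cross the lower seam: compare with `y` around the row `t₀ + L`
    refine ⟨(p.1, t₀ + L), fun a b ha hb => ?_⟩
    rw [abs_le] at ha hb
    dsimp only
    rw [hred]
    by_cases hb' : t₀ + b < j
    · rw [← hv₁ (p.1 + a) (t₀ + b), hv₂ (p.1 + a) (t₀ + b + L) (by omega) (by omega)]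
      exact apply_pair_congr y rfl (by ring)
    · rw [hv₂ (p.1 + a) (t₀ + b) (by omega) (by omega)]
      have key := hblock (p.1 + a) (t₀ + b - j) (by omega) (by omega)
      rw [apply_pair_congr y rfl (show j + (t₀ + b - j) + L = t₀ + L + b by ring),
        apply_pair_congr y rfl (show j + (t₀ + b - j) = t₀ + b by ring)] at key
      exact key.symm
  · -- the window may cross the upper seam: compare with `y` around the row `t₀`
    refine ⟨(p.1, t₀), fun a b ha hb => ?_⟩
    rw [abs_le] at ha hb
    dsimp only
    rw [hred]
    by_cases hb' : t₀ + b < j + L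
    · exact hv₂ _ _ (by omega) hb'
    · rw [apply_pair_congr v rfl (show t₀ + b = t₀ + b - L + L by ring), hv₁ (p.1 + a) (t₀ + b - L),
        hv₂ (p.1 + a) (t₀ + b - L) (by omega) (by omega)]
      have key := hblock (p.1 + a) (t₀ + b - L - j) (by omega) (by omega)
      rw [apply_pair_congr y rfl (show j + (t₀ + b - L - j) + L = t₀ + b by ring),
        apply_pair_congr y rfl (show j + (t₀ + b - L - j) = t₀ + b - L by ring)] at key
      exact key.symm

/-- **Vertical periodization.** Under the hypotheses of `mem_of_periodic_snd`, the vertical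
`L`-periodization `v (c, t) = y (c, j + ((t - j) mod L))` of the band `j ≤ t < j + L` of `y` lies
in `X`, is vertically `L`-periodic, agrees with `y` on the band, and keeps every horizontal
period of `y`. [folklore] -/
theorem exists_periodize_snd {X : Set (ℤ × ℤ → A)} {R : ℕ}
    (hmem : ∀ ⦃u y : ℤ × ℤ → A⦄, y ∈ X →
      (∀ p : ℤ × ℤ, ∃ p' : ℤ × ℤ, ∀ a b : ℤ, |a| ≤ R → |b| ≤ R →
        u (p.1 + a, p.2 + b) = y (p'.1 + a, p'.2 + b)) → u ∈ X)
    {y : ℤ × ℤ → A} (hy : y ∈ X) {j L : ℤ} (hL : 0 < L) (hRL : 2 * (R : ℤ) ≤ L)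
    (hblock : ∀ c a : ℤ, 0 ≤ a → a ≤ 2 * R → y (c, j + a + L) = y (c, j + a)) :
    ∃ v : ℤ × ℤ → A, v ∈ X ∧ (∀ c t : ℤ, v (c, t + L) = v (c, t)) ∧
      (∀ c t : ℤ, j ≤ t → t < j + L → v (c, t) = y (c, t)) ∧
      ∀ P : ℤ, (∀ c t : ℤ, y (c + P, t) = y (c, t)) → ∀ c t : ℤ, v (c + P, t) = v (c, t) := by
  have hv₁ : ∀ c t : ℤ, y (c, j + (t + L - j) % L) = y (c, j + (t - j) % L) := by
    intro c t
    rw [show t + L - j = (t - j) + L by ring, Int.add_emod_right]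
  have hv₂ : ∀ c t : ℤ, j ≤ t → t < j + L → y (c, j + (t - j) % L) = y (c, t) := by
    intro c t h1 h2
    rw [Int.emod_eq_of_lt (a := t - j) (b := L) (by omega) (by omega)]
    exact apply_pair_congr y rfl (by ring)
  exact ⟨fun p => y (p.1, j + (p.2 - j) % L), mem_of_periodic_snd hmem hy hL hRL hblock hv₁ hv₂,
    hv₁, hv₂, fun P hP c t => hP c _⟩

/-- Memory is symmetric in the two coordinates: the set of transposed configurations has the
same memory. [folklore] -/
theorem memory_transpose {X : Set (ℤ × ℤ → A)} {R : ℕ}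
    (hmem : ∀ ⦃u y : ℤ × ℤ → A⦄, y ∈ X →
      (∀ p : ℤ × ℤ, ∃ p' : ℤ × ℤ, ∀ a b : ℤ, |a| ≤ R → |b| ≤ R →
        u (p.1 + a, p.2 + b) = y (p'.1 + a, p'.2 + b)) → u ∈ X) :
    ∀ ⦃u y : ℤ × ℤ → A⦄, y ∈ {x : ℤ × ℤ → A | x ∘ Prod.swap ∈ X} →
      (∀ p : ℤ × ℤ, ∃ p' : ℤ × ℤ, ∀ a b : ℤ, |a| ≤ R → |b| ≤ R →
        u (p.1 + a, p.2 + b) = y (p'.1 + a, p'.2 + b)) →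
      u ∈ {x : ℤ × ℤ → A | x ∘ Prod.swap ∈ X} := by
  intro u y hy H
  show u ∘ Prod.swap ∈ X
  refine hmem hy fun p => ?_
  obtain ⟨p', hp'⟩ := H p.swap
  exact ⟨p'.swap, fun a b ha hb => hp' b a hb ha⟩

/-- **Horizontal periodization** (the transpose of `exists_periodize_snd`): if the columns
`j + a` and `j + a + L` of `y ∈ X` coincide for `0 ≤ a ≤ 2R` (`0 < L`, `2R ≤ L`, memory `R`),
the horizontal `L`-periodization of the band `j ≤ c < j + L` of `y` lies in `X`, is horizontally
`L`-periodic, agrees with `y` on the band, and keeps every vertical period of `y`. [folklore] -/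
theorem exists_periodize_fst {X : Set (ℤ × ℤ → A)} {R : ℕ}
    (hmem : ∀ ⦃u y : ℤ × ℤ → A⦄, y ∈ X →
      (∀ p : ℤ × ℤ, ∃ p' : ℤ × ℤ, ∀ a b : ℤ, |a| ≤ R → |b| ≤ R →
        u (p.1 + a, p.2 + b) = y (p'.1 + a, p'.2 + b)) → u ∈ X)
    {y : ℤ × ℤ → A} (hy : y ∈ X) {j L : ℤ} (hL : 0 < L) (hRL : 2 * (R : ℤ) ≤ L)
    (hblock : ∀ a t : ℤ, 0 ≤ a → a ≤ 2 * R → y (j + a + L, t) = y (j + a, t)) :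
    ∃ v : ℤ × ℤ → A, v ∈ X ∧ (∀ c t : ℤ, v (c + L, t) = v (c, t)) ∧
      (∀ c t : ℤ, j ≤ c → c < j + L → v (c, t) = y (c, t)) ∧
      ∀ Q : ℤ, (∀ c t : ℤ, y (c, t + Q) = y (c, t)) → ∀ c t : ℤ, v (c, t + Q) = v (c, t) := by
  have hyy : (y ∘ Prod.swap) ∘ Prod.swap = y := by
    funext p
    simp
  have hy' : y ∘ Prod.swap ∈ {x : ℤ × ℤ → A | x ∘ Prod.swap ∈ X} := by
    show (y ∘ Prod.swap) ∘ Prod.swap ∈ X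
    rw [hyy]
    exact hy
  obtain ⟨v, hvX, hv₁, hv₂, hv₃⟩ := exists_periodize_snd (memory_transpose hmem) hy' hL hRL
    (fun c a ha hb => hblock a c ha hb)
  exact ⟨v ∘ Prod.swap, hvX, fun c t => hv₁ t c, fun c t hc hc' => hv₂ t c hc hc',
    fun Q hQ c t => hv₃ Q (fun c' t' => hQ t' c') t c⟩

/-- **Periodic points through every pattern** (the core of Lightwood's theorem). For a strongly
irreducible `ℤ²`-subshift of finite type `X`, every `x ∈ X` and every `n`, some periodic
(finite-orbit) `z ∈ X` agrees with `x` on the box `[0, n)²`. Steps 1–3 of the module docstring: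
vertical recurrence, horizontal periodization, pigeonhole on row blocks.
[cite: Lightwood2003, dense periodic points; restated in CeccheriniSilbersteinCoornaert2012 §1] -/
theorem exists_hasFiniteOrbit_eqOn [Fintype A] [TopologicalSpace A] [DiscreteTopology A]
    {X : Set (ℤ × ℤ → A)} {g : ℝ} (hSFT : IsSFT X) (hSI : IsStronglyIrreducible X g)
    {x : ℤ × ℤ → A} (hx : x ∈ X) (n : ℕ) :
    ∃ z ∈ X, HasFiniteOrbit z ∧
      ∀ a b : ℤ, 0 ≤ a → a < n → 0 ≤ b → b < n → z (a, b) = x (a, b) := by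
  have hinv : IsShiftInvariant X := hSFT.isSubshift.2
  obtain ⟨R, hmem⟩ := hSFT.exists_memory
  obtain ⟨G, hG⟩ := exists_nat_gt g
  -- sizes: strips of width `s`, period `T = s + G`
  obtain ⟨s, hsn, hsR⟩ : ∃ s : ℕ, n ≤ s ∧ 2 * R + 1 ≤ s :=
    ⟨max n (2 * R + 1), le_max_left _ _, le_max_right _ _⟩
  obtain ⟨T, hT⟩ : ∃ T : ℕ, T = s + G := ⟨_, rfl⟩
  have hT0 : (0 : ℤ) < T := by omega
  have hRT : 2 * (R : ℤ) ≤ T := by omega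
  ---- Step 1: vertical recurrence (`x'` vertically `T`-periodic, `= x` on the rows `[0, s)`)
  obtain ⟨y₀, hy₀X, hy₀E, hy₀F⟩ :=
    glue_snd hSI hG hx (hinv.shift_mem ((0 : ℤ), -(T : ℤ)) hx) s
  have hblock₀ : ∀ c a : ℤ, 0 ≤ a → a ≤ 2 * R → y₀ (c, 0 + a + T) = y₀ (c, 0 + a) := by
    intro c a ha haR
    rw [hy₀F (c, 0 + a + T) (by dsimp only; omega), hy₀E (c, 0 + a) (by dsimp only; omega),
      shift_pair_apply]
    exact apply_pair_congr x (by ring) (by ring)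
  obtain ⟨x', hx'X, hx'per, hx'eq, -⟩ :=
    exists_periodize_snd hmem hy₀X (j := 0) (L := (T : ℤ)) hT0 hRT hblock₀
  have hx'x : ∀ c t : ℤ, 0 ≤ t → t < s → x' (c, t) = x (c, t) := fun c t h0 h1 => by
    rw [hx'eq c t h0 (by omega), hy₀E (c, t) (by dsimp only; omega)]
  ---- Step 2: horizontal periodization (`u` horizontally `T`-periodic, `= x'` on columns `[0, s)`)
  obtain ⟨y₁, hy₁X, hy₁E, hy₁F⟩ :=
    glue_fst hSI hG hx'X (hinv.shift_mem (-(T : ℤ), (0 : ℤ)) hx'X) s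
  have hblock₁ : ∀ a t : ℤ, 0 ≤ a → a ≤ 2 * R → y₁ (0 + a + T, t) = y₁ (0 + a, t) := by
    intro a t ha haR
    rw [hy₁F (0 + a + T, t) (by dsimp only; omega), hy₁E (0 + a, t) (by dsimp only; omega),
      shift_pair_apply]
    exact apply_pair_congr x' (by ring) (by ring)
  obtain ⟨u, huX, huper, hueq, -⟩ :=
    exists_periodize_fst hmem hy₁X (j := 0) (L := (T : ℤ)) hT0 hRT hblock₁
  have hux' : ∀ c t : ℤ, 0 ≤ c → c < s → u (c, t) = x' (c, t) := fun c t h0 h1 => by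
    rw [hueq c t h0 (by omega), hy₁E (c, t) (by dsimp only; omega)]
  -- all integer multiples of the periods
  have huperq : ∀ q c t : ℤ, u (c + q * T, t) = u (c, t) := fun q c t =>
    apply_add_int_mul_eq (f := fun c => u (c, t)) (fun c => huper c t) q c
  have hx'perq : ∀ q c t : ℤ, x' (c, t + q * T) = x' (c, t) := fun q c t =>
    apply_add_int_mul_eq (f := fun t => x' (c, t)) (fun t => hx'per c t) q t
  ---- Step 3: pigeonhole on the row blocks `u|[0,T) × [kT, kT + 2R]`
  obtain ⟨f, hf'⟩ : ∃ f : ℕ → Fin T → Fin (2 * R + 1) → A,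
      f = fun (k : ℕ) (i : Fin T) (a : Fin (2 * R + 1)) =>
        u (((i : ℕ) : ℤ), (k : ℤ) * T + ((a : ℕ) : ℤ)) := ⟨_, rfl⟩
  obtain ⟨k, k', hkk', hf⟩ : ∃ k k' : ℕ, k < k' ∧ f k = f k' := by
    obtain ⟨k₁, k₂, hne, h⟩ := Finite.exists_ne_map_eq_of_infinite f
    rcases lt_or_gt_of_ne hne with hlt | hlt
    · exact ⟨k₁, k₂, hlt, h⟩
    · exact ⟨k₂, k₁, hlt, h.symm⟩
  obtain ⟨d, rfl⟩ := Nat.exists_eq_add_of_lt hkk'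
  -- the band `[kT, k'T)` of `u`, of height `L = (d + 1) T`
  obtain ⟨j, hj⟩ : ∃ j : ℤ, j = (k : ℤ) * T := ⟨_, rfl⟩
  obtain ⟨L, hL⟩ : ∃ L : ℤ, L = ((d : ℤ) + 1) * T := ⟨_, rfl⟩
  have hL0 : 0 < L := by rw [hL]; exact mul_pos (by positivity) hT0
  have hTL : (T : ℤ) ≤ L := by rw [hL]; exact le_mul_of_one_le_left hT0.le (by omega)
  have hblock₂ : ∀ c a : ℤ, 0 ≤ a → a ≤ 2 * R → u (c, j + a + L) = u (c, j + a) := by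
    intro c a ha haR
    -- reduce the column modulo `T`
    have hc0 : 0 ≤ c % T := Int.emod_nonneg c hT0.ne'
    have hcT : c % T < T := Int.emod_lt_of_pos c hT0
    have hcol : ∀ t : ℤ, u (c, t) = u (c % T, t) := fun t => by
      have e := huperq (c / T) (c % T) t
      rwa [Int.emod_add_ediv_mul c T] at e
    rw [hcol, hcol]
    have key := congr_fun (congr_fun hf ⟨(c % T).toNat, by omega⟩) ⟨a.toNat, by omega⟩
    rw [hf'] at key
    dsimp only at key
    rw [Int.toNat_of_nonneg hc0, Int.toNat_of_nonneg ha] at key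
    rw [apply_pair_congr u rfl (show j + a + L = ((k + d + 1 : ℕ) : ℤ) * T + a by
        rw [hj, hL]; push_cast; ring),
      apply_pair_congr u rfl (show j + a = (k : ℤ) * T + a by rw [hj])]
    exact key.symm
  obtain ⟨v, hvX, hvper, hveq, hvper'⟩ := exists_periodize_snd hmem huX hL0 (by omega) hblock₂
  have hvP : ∀ c t : ℤ, v (c + T, t) = v (c, t) := hvper' T huper
  ---- Step 4: the periodic point `shift (0, kT) v`
  refine ⟨shift ((0 : ℤ), j) v, hinv.shift_mem _ hvX, ?_, ?_⟩
  · refine hasFiniteOrbit_shift ((hasFiniteOrbit_iff_exists_shift_eq v).mpr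
      ⟨T, (d + 1) * T, by omega, Nat.mul_pos (by omega) (by omega), ?_, ?_⟩) _
    · ext ⟨c, t⟩
      show v ((T : ℤ) + c, 0 + t) = v (c, t)
      rw [zero_add, add_comm, hvP]
    · ext ⟨c, t⟩
      show v (0 + c, (((d + 1) * T : ℕ) : ℤ) + t) = v (c, t)
      rw [zero_add, show (((d + 1) * T : ℕ) : ℤ) + t = t + L by rw [hL]; push_cast; ring, hvper]
  · intro a b ha han hb hbn
    show v (0 + a, j + b) = x (a, b)
    rw [zero_add, hveq a (j + b) (by omega) (by omega), hux' a (j + b) ha (by omega),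
      show j + b = b + (k : ℤ) * T by rw [hj]; ring, hx'perq, hx'x a b hb (by omega)]

end Lightwood2003

/-- **Lightwood (2003): strongly irreducible `ℤ²`-SFTs have dense periodic points** — discharge
of the named fact `Lightwood2003_densePeriodic`: for a finite discrete alphabet `A`, an SFT
`X ⊆ A^{ℤ²}` (window form) strongly irreducible with some gap `g` satisfies
`X ⊆ closure {x ∈ X | HasFiniteOrbit x}`. Proof: an open neighbourhood of `x ∈ X` contains a
cylinder on a finite set `I ⊆ [-m, m]²` (`isOpen_pi_iff`); apply
`Lightwood2003.exists_hasFiniteOrbit_eqOn` to `shift (-m, -m) x` and the box `[0, 2m]²` and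
shift back.
[cite: Lightwood2003, dense periodic points; restated in CeccheriniSilbersteinCoornaert2012 §1] -/
theorem Lightwood2003_densePeriodic_holds : Lightwood2003_densePeriodic := by
  intro A _ _ _ X g hSFT hSI x hx
  rw [mem_closure_iff]
  intro O hO hxO
  obtain ⟨I, t, htI, hIO⟩ := isOpen_pi_iff.mp hO x hxO
  obtain ⟨m, hm⟩ := Lightwood2003.exists_abs_le_of_finset I
  have hinv : IsShiftInvariant X := hSFT.isSubshift.2
  obtain ⟨z, hzX, hzper, hzeq⟩ := Lightwood2003.exists_hasFiniteOrbit_eqOn hSFT hSI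
    (hinv.shift_mem (-(m : ℤ), -(m : ℤ)) hx) (2 * m + 1)
  refine ⟨shift ((m : ℤ), (m : ℤ)) z, hIO ?_, hinv.shift_mem _ hzX, hasFiniteOrbit_shift hzper _⟩
  rw [Set.mem_pi]
  intro i hi
  obtain ⟨h1, h2⟩ := hm i hi
  rw [abs_le] at h1 h2
  have e : shift ((m : ℤ), (m : ℤ)) z i = x i := by
    calc shift ((m : ℤ), (m : ℤ)) z i = z ((m : ℤ) + i.1, (m : ℤ) + i.2) := rfl
      _ = shift (-(m : ℤ), -(m : ℤ)) x ((m : ℤ) + i.1, (m : ℤ) + i.2) :=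
          hzeq _ _ (by omega) (by push_cast; omega) (by omega) (by push_cast; omega)
      _ = x i := by
          rw [Lightwood2003.shift_pair_apply, neg_add_cancel_left, neg_add_cancel_left]
  rw [e]
  exact (htI i hi).2

end Literature.Dynamics.SymbolicDynamics
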